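import Literature.Topology.FourManifolds.BordismFourNormalization
import Literature.Topology.FourManifolds.MappingTorusHomology
import Literature.AlgebraicTopology.SingularHomology.LocalHomologyVanishing
import Literature.AlgebraicTopology.SingularHomology.FundamentalClassExistence
import Mathlib.Analysis.Normed.Module.RCLike.Real
import HarnessLib

/-!
# The transported class is a relative fundamental class; the normalization `hA1`
(Layer 4b of `Literature.Topology.FourManifolds.isOrientedBordant_iff_signature_eq`)

Sibling proof file of `Literature.Topology.FourManifolds.BordismFourNormalization`.  That file
replaces a homological oriented-bordism datum `(c, w)` (`Literature.Topology.FourManifolds.IsOrientedBordant`: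
`w ∈ H₅(W, ∂W; ℤ)`, `∂w = (inl)_*[M] − (inr)_*[N]`) by the datum `(W', w' = g_* w)` on the
essential part `W' ⊆ W` (the components of `W` meeting `∂W`), with the same Thom rank `r₂`.  Here
we finish hypothesis `hA1` of `Literature.Topology.FourManifolds.two_mul_boundaryImageRank_eq_of_normalization`:

* `Literature.Topology.FourManifolds.isRelFundamentalClass_of_isGenerator_toLocal_δ` (**the per-component argument**, for a
  compact topological `(n+1)`-manifold with boundary `X` every component of which contains two
  boundary points): if `∂w` restricts to a generator of `Hₙ(∂X | y)` at every boundary point `y`,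
  then `w` is a relative fundamental class (Spanier's definition, `Literature.AlgebraicTopology.SingularHomology.IsRelFundamentalClass`).
  Proof, for an interior point `x` with component `K`: collapse `X → K` (identity on the clopen
  `K`, constant at a boundary point `b ∈ K` elsewhere) and push `w` to `w_K ∈ Hₙ₊₁(K, ∂K)`; at a
  second boundary point `y ≠ b` of `K` the collapse is a local homeomorphism, so `∂w_K` is a local
  generator at `y`, in particular `w_K ≠ 0`; by **Spanier Thm. 6.3.5** (named fact
  `relativeSingularHomology.exists_linearEquiv_of_ne_zero`, hypothesis `h635`)
  `Hₙ₊₁(K, ∂K; R) ≅ R` with generators fundamental, so `w_K = k • g₀` with `g₀` fundamental; by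
  **Spanier Cor. 6.3.10** (named fact `isGenerator_toLocal_δ_of_isRelFundamentalClass`, hypothesis
  `h6310`) `∂g₀` is a local generator at `y`, and comparing with `∂w_K = k • ∂g₀` shows `k` is a
  unit, so `w_K` is fundamental; finally the collapse is a local homeomorphism at the interior
  point `x`, so `w` is a local generator at `x`.
* `Literature.Topology.FourManifolds.BoundarySplitting.isGenerator_toLocal_of_eq_sub` (**the hypothesis on `∂w`** for a
  boundary splitting `∂W = M ⊔ N`): `(iM)_*[M] − (iN)_*[N]` is a local generator at every boundary
  point, because `iM`, `iN` are open embeddings into `∂W` (local homology is local) and `[M]`,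
  `[N]` are fundamental classes (hypotheses; for closed manifolds this is the named fact
  `HomologicalOrientation.isFundamentalClass_fundamentalClass`, Hatcher Thm. 3.26).
* `Literature.Topology.FourManifolds.Cobordism.exists_boundary_pair_essentialOpens`: every component of the essential part of
  a cobordism of positive-dimensional manifolds contains two boundary points (a topological
  manifold of positive dimension has no isolated points).
* `Literature.Topology.FourManifolds.exists_orientedSplitting` (**`hA1`**, modulo the named facts `h635`, `h6310` and
  the fundamental class of the ends, `hμ`), including the degenerate case `∂W = ∅` (then
  `M = N = ∅`, the essential part is empty and both ranks vanish), and the assemblies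
  `Literature.Topology.FourManifolds.two_mul_boundaryImageRank_eq_of_facts` (Thom 1952, Cor. V.8 for `n = 4`, `p = 2`,
  from textbook named facts only; `hμ` is fed by the discharged Hatcher Thm. 3.26,
  `HomologicalOrientation.isFundamentalClass_fundamentalClass_holds` of
  `…FundamentalClassExistence`) and `Literature.Topology.FourManifolds.isOrientedBordant_iff_signature_eq_of_facts`
  (spc4.S36 from textbook named facts and Thom's Thm IV.13).

Supporting generalities (all proved, [folklore]): generators of cyclic modules under linear
isomorphisms; local homology under open embeddings and under retractions of open embeddings
(Hatcher 2002, §3.3 p. 231, "local homology depends only on a neighbourhood", from the proved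
excision `localHomology.isIso_map_subsetIncl_of_isOpen`); the collapse onto a clopen subset
(`Hₖ(∅) = 0` is `Literature.Topology.FourManifolds.isZero_singularHomology_of_isEmpty` of `…MappingTorusHomology`).

## References

* E. H. Spanier, *Algebraic Topology*, Springer 1981, Ch. 6 §3, Thm. 5, Cor. 10. [Spanier1981]
* A. Hatcher, *Algebraic Topology*, CUP 2002, §3.3, pp. 231–236, 252–254. [Hatcher2002]
* R. Thom, *Espaces fibrés en sphères et carrés de Steenrod*, Ann. Sci. ENS 69 (1952), Cor. V.8
  (p. 173). [Thom1952]
* R. Thom, *Quelques propriétés globales des variétés différentiables*, Comment. Math. Helv. 28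
  (1954), Thm IV.1, Thm IV.13. [ThomCMH1954]
-/

noncomputable section

open scoped Manifold ContDiff Topology
open Set CategoryTheory Limits Topology

universe u v w

namespace Literature.Topology.FourManifolds

/-! ### Generators of rank-one modules under linear isomorphisms -/

section Generator

variable {R : Type v} [CommRing R]

/-- An element sent to `1` by some linear isomorphism onto `R` ("generator", as in
`Literature.AlgebraicTopology.SingularHomology.HomologicalOrientation.isGenerator`) stays one under any linear isomorphism. [folklore] -/
lemma exists_linearEquiv_apply_eq_one_of_linearEquiv {V W : Type*} [AddCommGroup V] [Module R V]
    [AddCommGroup W] [Module R W] (f : V ≃ₗ[R] W) {x : V} (h : ∃ e : V ≃ₗ[R] R, e x = 1) :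
    ∃ e : W ≃ₗ[R] R, e (f x) = 1 := by
  obtain ⟨e, he⟩ := h
  exact ⟨f.symm.trans e, by simpa using he⟩

/-- Generators are preserved and reflected by isomorphisms of `R`-modules (categorical form). [folklore] -/
lemma exists_linearEquiv_apply_eq_one_iff_of_isIso {V W : ModuleCat.{w} R} (f : V ⟶ W) [IsIso f]
    (x : V) : (∃ e : W ≃ₗ[R] R, e (f x) = 1) ↔ ∃ e : V ≃ₗ[R] R, e x = 1 := by
  constructor
  · rintro ⟨e, he⟩
    exact ⟨(asIso f).toLinearEquiv.trans e, he⟩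
  · rintro ⟨e, he⟩
    refine ⟨(asIso f).toLinearEquiv.symm.trans e, ?_⟩
    rw [LinearEquiv.trans_apply, show f x = (asIso f).toLinearEquiv x from rfl,
      LinearEquiv.symm_apply_apply, he]

/-- The negative of a generator is a generator. [folklore] -/
lemma exists_linearEquiv_apply_eq_one_neg {V : Type*} [AddCommGroup V] [Module R V] {x : V}
    (h : ∃ e : V ≃ₗ[R] R, e x = 1) : ∃ e : V ≃ₗ[R] R, e (-x) = 1 := by
  obtain ⟨e, he⟩ := h
  exact ⟨e.trans (LinearEquiv.neg R), by simp [he]⟩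

/-- A generator is nonzero when `R` is nontrivial. [folklore] -/
lemma ne_zero_of_exists_linearEquiv_apply_eq_one [Nontrivial R] {V : Type*} [AddCommGroup V]
    [Module R V] {x : V} (h : ∃ e : V ≃ₗ[R] R, e x = 1) : x ≠ 0 := by
  obtain ⟨e, he⟩ := h
  rintro rfl
  rw [map_zero] at he
  exact zero_ne_one he

/-- *Every* linear isomorphism onto `R` sends a generator to a unit (two isomorphisms `V ≃ R`
differ by a unit of `R`). [folklore] -/
lemma isUnit_apply_of_exists_linearEquiv_apply_eq_one {V : Type*} [AddCommGroup V] [Module R V]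
    {x : V} (h : ∃ e : V ≃ₗ[R] R, e x = 1) (e' : V ≃ₗ[R] R) : IsUnit (e' x) := by
  obtain ⟨e, he⟩ := h
  have hx : x = e.symm 1 := by rw [← he, LinearEquiv.symm_apply_apply]
  subst hx
  have key : e (e'.symm 1) • e.symm 1 = e'.symm 1 := by
    apply e.injective
    rw [map_smul, LinearEquiv.apply_symm_apply, smul_eq_mul, mul_one]
  refine isUnit_iff_exists_inv'.mpr ⟨e (e'.symm 1), ?_⟩
  rw [← smul_eq_mul, ← map_smul, key, LinearEquiv.apply_symm_apply]

end Generator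

/-! ### Elements of zero objects; homology of the empty space -/

section Zero

variable (R : Type v) [CommRing R]

/-- An element of a zero object of `ModuleCat` is zero. [folklore] -/
lemma eq_zero_of_isZero {V : ModuleCat.{w} R} (h : IsZero V) (a : V) : a = 0 := by
  have h1 : (𝟙 V : V ⟶ V) = 0 := h.eq_of_src _ _
  have h2 : (𝟙 V : V ⟶ V) a = (0 : V ⟶ V) a := by rw [h1]
  rw [ModuleCat.id_apply] at h2
  rw [h2]
  rfl

end Zero

/-! ### Local homology under open embeddings and retractions -/

section LocalMaps

variable (R : Type v) [CommRing R] (M' : Type v) [AddCommGroup M'] [Module R M']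
variable {P Z : Type u} [TopologicalSpace P] [TopologicalSpace Z]

omit [TopologicalSpace P] [TopologicalSpace Z] in
/-- An injective map is a map of pairs `(P, P ∖ p) → (Z, Z ∖ f p)`. [folklore] -/
lemma mapsTo_compl_singleton_of_injective (f : P → Z) (hf : Function.Injective f) (p : P) :
    MapsTo f ({p}ᶜ : Set P) ({f p}ᶜ : Set Z) := fun _ hq h => hq (hf h)

/-- Naturality of `Hₖ(P) → Hₖ(P | p)` for a map of pairs `(P, P ∖ p) → (Z, Z ∖ z)`, elementwise
(Hatcher 2002, §3.3; naturality of the sequence of the pair). [cite: Hatcher2002, §2.1 (naturality)] -/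
lemma _root_.Literature.AlgebraicTopology.SingularHomology.singularHomology.toLocal_map_apply (f : C(P, Z)) (p : P) (z : Z)
    (h : MapsTo f ({p}ᶜ : Set P) ({z}ᶜ : Set Z)) (k : ℕ) (a : Literature.AlgebraicTopology.SingularHomology.singularHomology R M' P k) :
    Literature.AlgebraicTopology.SingularHomology.singularHomology.toLocal R M' z k (Literature.AlgebraicTopology.SingularHomology.singularHomology.map R M' f k a) =
      Literature.AlgebraicTopology.SingularHomology.relativeSingularHomology.map R M' f h k (Literature.AlgebraicTopology.SingularHomology.singularHomology.toLocal R M' p k a) := by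
  change (Literature.AlgebraicTopology.SingularHomology.singularHomology.map R M' f k ≫ Literature.AlgebraicTopology.SingularHomology.relativeSingularHomology.ofAbsolute R M' Z {z}ᶜ k) a =
    (Literature.AlgebraicTopology.SingularHomology.relativeSingularHomology.ofAbsolute R M' P {p}ᶜ k ≫ Literature.AlgebraicTopology.SingularHomology.relativeSingularHomology.map R M' f h k) a
  rw [Literature.AlgebraicTopology.SingularHomology.relativeSingularHomology.ofAbsolute_comp_map]

/-- Naturality of the local image `Hₖ(P, A) → Hₖ(P | p)` of relative classes at interior points,
for a map of pairs `f : (P, A) → (Z, B)` which is also a map of pairs `(P, P ∖ p) → (Z, Z ∖ z)`,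
elementwise. [cite: Hatcher2002, §2.1 (naturality)] -/
lemma _root_.Literature.AlgebraicTopology.SingularHomology.relativeSingularHomology.toLocal_map_apply {A : Set P} {B : Set Z} (f : C(P, Z))
    (hAB : MapsTo f A B) (p : ↥Aᶜ) (z : ↥Bᶜ)
    (h : MapsTo f ({(p : P)}ᶜ : Set P) ({(z : Z)}ᶜ : Set Z)) (k : ℕ)
    (a : Literature.AlgebraicTopology.SingularHomology.relativeSingularHomology R M' P A k) :
    Literature.AlgebraicTopology.SingularHomology.relativeSingularHomology.toLocal R M' B z k (Literature.AlgebraicTopology.SingularHomology.relativeSingularHomology.map R M' f hAB k a) =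
      Literature.AlgebraicTopology.SingularHomology.relativeSingularHomology.map R M' f h k (Literature.AlgebraicTopology.SingularHomology.relativeSingularHomology.toLocal R M' A p k a) := by
  change (Literature.AlgebraicTopology.SingularHomology.relativeSingularHomology.map R M' f hAB k ≫
      Literature.AlgebraicTopology.SingularHomology.relativeSingularHomology.map R M' (ContinuousMap.id Z) (Literature.AlgebraicTopology.SingularHomology.mapsTo_id_compl_singleton z) k) a =
    (Literature.AlgebraicTopology.SingularHomology.relativeSingularHomology.map R M' (ContinuousMap.id P) (Literature.AlgebraicTopology.SingularHomology.mapsTo_id_compl_singleton p) k ≫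
      Literature.AlgebraicTopology.SingularHomology.relativeSingularHomology.map R M' f h k) a
  rw [← Literature.AlgebraicTopology.SingularHomology.relativeSingularHomology.map_comp, ← Literature.AlgebraicTopology.SingularHomology.relativeSingularHomology.map_comp]
  rfl

/-- A class pushed forward along a map missing `z` has zero local image at `z`
(it comes from `Hₖ(Z ∖ z)`, and `Hₖ(P, P) = 0`). [cite: Hatcher2002, §3.3 p. 236 (Lemma 3.27, support)] -/
lemma _root_.Literature.AlgebraicTopology.SingularHomology.singularHomology.toLocal_map_eq_zero_of_forall_ne (f : C(P, Z)) (z : Z) (hf : ∀ p, f p ≠ z)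
    (k : ℕ) (a : Literature.AlgebraicTopology.SingularHomology.singularHomology R M' P k) :
    Literature.AlgebraicTopology.SingularHomology.singularHomology.toLocal R M' z k (Literature.AlgebraicTopology.SingularHomology.singularHomology.map R M' f k a) = 0 := by
  have h : MapsTo f (univ : Set P) ({z}ᶜ : Set Z) := fun p _ => hf p
  have hz : Literature.AlgebraicTopology.SingularHomology.relativeSingularHomology.ofAbsolute R M' P univ k = 0 :=
    (Literature.AlgebraicTopology.SingularHomology.isZero_relativeSingularHomology_univ R M' k).eq_of_tgt _ _
  change (Literature.AlgebraicTopology.SingularHomology.singularHomology.map R M' f k ≫ Literature.AlgebraicTopology.SingularHomology.relativeSingularHomology.ofAbsolute R M' Z {z}ᶜ k) a = 0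
  rw [← Literature.AlgebraicTopology.SingularHomology.relativeSingularHomology.ofAbsolute_comp_map R M' f h k, hz, zero_comp]
  rfl

/-- Excision for local homology at an open subset, with the point given as an element of the
subtype (repackaging of `localHomology.isIso_map_subsetIncl_of_isOpen`). [cite: Hatcher2002, §3.3 p. 231] -/
theorem _root_.Literature.AlgebraicTopology.SingularHomology.localHomology.isIso_map_subsetIncl_of_isOpen' [T1Space Z] {O : Set Z} (hO : IsOpen O)
    (o : ↥O) (h : MapsTo (Literature.AlgebraicTopology.SingularHomology.subsetIncl O) ({o}ᶜ : Set ↥O) ({(o : Z)}ᶜ : Set Z)) (k : ℕ) :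
    IsIso (Literature.AlgebraicTopology.SingularHomology.relativeSingularHomology.map R M' (Literature.AlgebraicTopology.SingularHomology.subsetIncl O) h k) := by
  obtain ⟨x, hx⟩ := o
  exact Literature.AlgebraicTopology.SingularHomology.localHomology.isIso_map_subsetIncl_of_isOpen R M' hO hx k

/-- **Local homology is invariant under open embeddings**: an open embedding `f : P → Z`
induces isomorphisms `Hₖ(P | p; M) ≅ Hₖ(Z | f p; M)` (it is a homeomorphism onto the open subset
`f(P)`, and local homology depends only on a neighbourhood: Hatcher 2002, §3.3, p. 231).  PROVED
from excision (`localHomology.isIso_map_subsetIncl_of_isOpen`). [cite: Hatcher2002, §3.3 p. 231] -/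
theorem _root_.Literature.AlgebraicTopology.SingularHomology.localHomology.isIso_map_of_isOpenEmbedding [T1Space Z] (f : C(P, Z))
    (hf : IsOpenEmbedding f) (p : P) (h : MapsTo f ({p}ᶜ : Set P) ({f p}ᶜ : Set Z)) (k : ℕ) :
    IsIso (Literature.AlgebraicTopology.SingularHomology.relativeSingularHomology.map R M' f h k) := by
  set e : P ≃ₜ ↥(range f) := hf.toIsEmbedding.toHomeomorph with he
  have h₁ : MapsTo (e : C(P, ↥(range f))) ({p}ᶜ : Set P) ({e p}ᶜ : Set ↥(range f)) :=
    fun q hq hq' => hq (e.injective hq')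
  have h₂ : MapsTo (Literature.AlgebraicTopology.SingularHomology.subsetIncl (range f)) ({e p}ᶜ : Set ↥(range f)) ({f p}ᶜ : Set Z) :=
    fun q hq hq' => hq (Subtype.ext hq')
  have hfac : Literature.AlgebraicTopology.SingularHomology.relativeSingularHomology.map R M' f h k =
      Literature.AlgebraicTopology.SingularHomology.relativeSingularHomology.map R M' (e : C(P, ↥(range f))) h₁ k ≫
        Literature.AlgebraicTopology.SingularHomology.relativeSingularHomology.map R M' (Literature.AlgebraicTopology.SingularHomology.subsetIncl (range f)) h₂ k := by
    rw [← Literature.AlgebraicTopology.SingularHomology.relativeSingularHomology.map_comp]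
    rfl
  rw [hfac]
  haveI i1 : IsIso (Literature.AlgebraicTopology.SingularHomology.relativeSingularHomology.map R M' (e : C(P, ↥(range f))) h₁ k) :=
    inferInstanceAs (IsIso (Literature.AlgebraicTopology.SingularHomology.localHomology.mapIso R M' e p k).hom)
  haveI i2 : IsIso (Literature.AlgebraicTopology.SingularHomology.relativeSingularHomology.map R M' (Literature.AlgebraicTopology.SingularHomology.subsetIncl (range f)) h₂ k) :=
    Literature.AlgebraicTopology.SingularHomology.localHomology.isIso_map_subsetIncl_of_isOpen' R M' hf.isOpen_range (e p) h₂ k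
  exact IsIso.comp_isIso

/-- **A retraction of an open embedding is a local-homology isomorphism at points with a single
preimage.**  Let `j : U → Z` with `r ∘ j = id` and suppose `j` induces an isomorphism
`Hₖ(U | u₀) ≅ Hₖ(Z | z₀)` (e.g. `j` an open embedding, `z₀ = j u₀`) and `r` is a map of pairs
`(Z, Z ∖ z₀) → (U, U ∖ u₀)` (i.e. `r⁻¹(u₀) = {z₀}`).  Then `r` induces an isomorphism
`Hₖ(Z | z₀) ≅ Hₖ(U | u₀)`, inverse to that of `j`. [folklore] -/
theorem _root_.Literature.AlgebraicTopology.SingularHomology.localHomology.isIso_map_of_comp_eq_id {U : Type u} [TopologicalSpace U] (j : C(U, Z))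
    (r : C(Z, U)) (hrj : r.comp j = ContinuousMap.id U) (u₀ : U) {z₀ : Z}
    (hj : MapsTo j ({u₀}ᶜ : Set U) ({z₀}ᶜ : Set Z)) (hr : MapsTo r ({z₀}ᶜ : Set Z) ({u₀}ᶜ : Set U))
    (k : ℕ) [IsIso (Literature.AlgebraicTopology.SingularHomology.relativeSingularHomology.map R M' j hj k)] :
    IsIso (Literature.AlgebraicTopology.SingularHomology.relativeSingularHomology.map R M' r hr k) := by
  have key : ∀ (g : C(U, U)) (hg : MapsTo g ({u₀}ᶜ : Set U) ({u₀}ᶜ : Set U)),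
      g = ContinuousMap.id U → Literature.AlgebraicTopology.SingularHomology.relativeSingularHomology.map R M' g hg k = 𝟙 _ := by
    rintro g hg rfl
    exact Literature.AlgebraicTopology.SingularHomology.relativeSingularHomology.map_id R M' _ k
  have hcomp : Literature.AlgebraicTopology.SingularHomology.relativeSingularHomology.map R M' j hj k ≫ Literature.AlgebraicTopology.SingularHomology.relativeSingularHomology.map R M' r hr k =
      𝟙 _ := by
    rw [← Literature.AlgebraicTopology.SingularHomology.relativeSingularHomology.map_comp]
    exact key _ _ hrj
  haveI : IsIso (Literature.AlgebraicTopology.SingularHomology.relativeSingularHomology.map R M' j hj k ≫ Literature.AlgebraicTopology.SingularHomology.relativeSingularHomology.map R M' r hr k) := by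
    rw [hcomp]
    infer_instance
  exact IsIso.of_isIso_comp_left (Literature.AlgebraicTopology.SingularHomology.relativeSingularHomology.map R M' j hj k) _

end LocalMaps

/-! ### The collapse onto a clopen subset -/

section ClopenCollapse

variable {X : Type u} [TopologicalSpace X] (A : Set X) (hA : IsClopen A) (a : ↥A)

/-- `sumOfIsClopen.symm x = inl x` for `x ∈ A`. [folklore] -/
lemma Homeomorph.sumOfIsClopen_symm_apply_of_mem (x : X) (hx : x ∈ A) :
    (Literature.AlgebraicTopology.SingularHomology.Homeomorph.sumOfIsClopen A hA).symm x = Sum.inl ⟨x, hx⟩ :=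
  (Literature.AlgebraicTopology.SingularHomology.Homeomorph.sumOfIsClopen A hA).injective
    (by rw [Homeomorph.apply_symm_apply, Literature.AlgebraicTopology.SingularHomology.Homeomorph.sumOfIsClopen_inl])

/-- `sumOfIsClopen.symm x = inr x` for `x ∉ A`. [folklore] -/
lemma Homeomorph.sumOfIsClopen_symm_apply_of_not_mem (x : X) (hx : x ∉ A) :
    (Literature.AlgebraicTopology.SingularHomology.Homeomorph.sumOfIsClopen A hA).symm x = Sum.inr ⟨x, hx⟩ :=
  (Literature.AlgebraicTopology.SingularHomology.Homeomorph.sumOfIsClopen A hA).injective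
    (by rw [Homeomorph.apply_symm_apply, Literature.AlgebraicTopology.SingularHomology.Homeomorph.sumOfIsClopen_inr])

/-- **The collapse onto a clopen subset** `A ⊆ X`: the identity on `A` and constant `a` off `A`
(continuous through `X ≅ A ⊔ (X ∖ A)`).  For `A` the essential part of a cobordism this is
`Literature.Topology.FourManifolds.Cobordism.collapse`. [folklore] -/
def clopenCollapse : C(X, ↥A) :=
  (⟨Sum.elim id (fun _ => a), continuous_id.sumElim continuous_const⟩ : C(↥A ⊕ ↥(Aᶜ), ↥A)).comp
    ((Literature.AlgebraicTopology.SingularHomology.Homeomorph.sumOfIsClopen A hA).symm : C(X, ↥A ⊕ ↥(Aᶜ)))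

/-- On `A` the collapse is the identity. [folklore] -/
lemma clopenCollapse_apply_of_mem (x : X) (hx : x ∈ A) : clopenCollapse A hA a x = ⟨x, hx⟩ := by
  change Sum.elim id (fun _ => a) ((Literature.AlgebraicTopology.SingularHomology.Homeomorph.sumOfIsClopen A hA).symm x) = _
  rw [Homeomorph.sumOfIsClopen_symm_apply_of_mem A hA x hx]
  rfl

/-- Off `A` the collapse is constant. [folklore] -/
lemma clopenCollapse_apply_of_not_mem (x : X) (hx : x ∉ A) : clopenCollapse A hA a x = a := by
  change Sum.elim id (fun _ => a) ((Literature.AlgebraicTopology.SingularHomology.Homeomorph.sumOfIsClopen A hA).symm x) = _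
  rw [Homeomorph.sumOfIsClopen_symm_apply_of_not_mem A hA x hx]
  rfl

/-- On points of `A` the collapse is the identity. [folklore] -/
@[simp]
lemma clopenCollapse_apply_coe (x : ↥A) : clopenCollapse A hA a x = x := by
  rw [clopenCollapse_apply_of_mem A hA a x x.2]

/-- The collapse retracts the inclusion: `r ∘ j = id`. [folklore] -/
lemma clopenCollapse_comp_subsetIncl : (clopenCollapse A hA a).comp (Literature.AlgebraicTopology.SingularHomology.subsetIncl A) = ContinuousMap.id ↥A :=
  ContinuousMap.ext fun x => clopenCollapse_apply_coe A hA a x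

/-- A point `x ∈ A` other than the base point has itself as only preimage: the collapse is a map
of pairs `(X, X ∖ x) → (A, A ∖ x)`. [folklore] -/
lemma mapsTo_clopenCollapse_compl_singleton (x : ↥A) (hx : x ≠ a) :
    MapsTo (clopenCollapse A hA a) ({(x : X)}ᶜ : Set X) ({x}ᶜ : Set ↥A) := by
  intro z hz h
  rw [mem_singleton_iff] at h
  by_cases hzA : z ∈ A
  · rw [clopenCollapse_apply_of_mem A hA a z hzA] at h
    exact hz (congrArg Subtype.val h)
  · rw [clopenCollapse_apply_of_not_mem A hA a z hzA] at h
    exact hx h.symm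

end ClopenCollapse

/-! ### The per-component argument: `w` is a relative fundamental class -/

section Fundamental

variable {R : Type v} [CommRing R] [IsDomain R] [IsPrincipalIdealRing R]

/-- **A relative class whose boundary is a fundamental class of `∂X` is a fundamental class**,
for `X` a compact topological `(n+1)`-manifold with boundary every component of which contains
two distinct boundary points (hypothesis `htwo`; automatic when every component meets `∂X` and
`n ≥ 1`).  Precisely: if the local image of `∂w` at every `y ∈ ∂X` generates `Hₙ(∂X | y; R)`, then
`w ∈ Hₙ₊₁(X, ∂X; R)` is a relative fundamental class (Spanier's definition).  The inputs from
the literature are the named facts Spanier Thm. 6.3.5 (`h635`: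
`relativeSingularHomology.exists_linearEquiv_of_ne_zero`, on the components of `X`) and Spanier
Cor. 6.3.10 (`h6310`: `isGenerator_toLocal_δ_of_isRelFundamentalClass`); the rest — collapsing
onto a component, locality of local homology, comparison of generators — is proved here.  This is
the converse direction of Spanier Cor. 6.3.10 used implicitly in the classical identification of
oriented bordism with its homological formulation (Milnor–Stasheff §17, p. 200).
[cite: Spanier1981, Ch. 6 Sec. 3 Thm. 5 and Cor. 10] -/
theorem isRelFundamentalClass_of_isGenerator_toLocal_δ {n : ℕ} {X : Type u} [TopologicalSpace X]
    [T2Space X] [CompactSpace X] [ChartedSpace (EuclideanHalfSpace (n + 1)) X]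
    (h635 : ∀ {W : Type u} [TopologicalSpace W] [T2Space W] [CompactSpace W] [ConnectedSpace W]
      [ChartedSpace (EuclideanHalfSpace (n + 1)) W]
      (h : ∃ z : ↥(Literature.AlgebraicTopology.SingularHomology.relativeSingularHomology R R W ((𝓡∂ (n + 1)).boundary W) (n + 1)), z ≠ 0),
      Literature.AlgebraicTopology.SingularHomology.relativeSingularHomology.exists_linearEquiv_of_ne_zero R n W h)
    (h6310 : ∀ {W : Type u} [TopologicalSpace W] [T2Space W] [CompactSpace W]
      [ChartedSpace (EuclideanHalfSpace (n + 1)) W]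
      (z : ↥(Literature.AlgebraicTopology.SingularHomology.relativeSingularHomology R R W ((𝓡∂ (n + 1)).boundary W) (n + 1)))
      (hz : Literature.AlgebraicTopology.SingularHomology.IsRelFundamentalClass R ((𝓡∂ (n + 1)).boundary W) z),
      Literature.AlgebraicTopology.SingularHomology.isGenerator_toLocal_δ_of_isRelFundamentalClass R n W z hz)
    (w : ↥(Literature.AlgebraicTopology.SingularHomology.relativeSingularHomology R R X ((𝓡∂ (n + 1)).boundary X) (n + 1)))
    (hgen : ∀ y : ↥((𝓡∂ (n + 1)).boundary X),
      ∃ e : Literature.AlgebraicTopology.SingularHomology.localHomology R R ↥((𝓡∂ (n + 1)).boundary X) y n ≃ₗ[R] R,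
        e (Literature.AlgebraicTopology.SingularHomology.singularHomology.toLocal R R y n
          (Literature.AlgebraicTopology.SingularHomology.relativeSingularHomology.δ R R X ((𝓡∂ (n + 1)).boundary X) n w)) = 1)
    (htwo : ∀ x : X, ∃ y ∈ (𝓡∂ (n + 1)).boundary X, ∃ y' ∈ (𝓡∂ (n + 1)).boundary X,
      y ≠ y' ∧ y ∈ connectedComponent x ∧ y' ∈ connectedComponent x) :
    Literature.AlgebraicTopology.SingularHomology.IsRelFundamentalClass R ((𝓡∂ (n + 1)).boundary X) w := by
  classical
  haveI : LocallyConnectedSpace X := ChartedSpace.locallyConnectedSpace (EuclideanHalfSpace (n + 1)) X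
  intro x
  obtain ⟨y, hy, y', hy', hyy', hyx, hy'x⟩ := htwo x
  -- the component `K` of `x`, a compact connected manifold with boundary `∂K = K ∩ ∂X`
  obtain ⟨K, hKdef⟩ : ∃ K : Set X, K = connectedComponent (x : X) := ⟨_, rfl⟩
  have hK : IsClopen K := by rw [hKdef]; exact isClopen_connectedComponent
  have hxK : (x : X) ∈ K := by rw [hKdef]; exact mem_connectedComponent
  have hyK : y ∈ K := by rw [hKdef]; exact hyx
  have hy'K : y' ∈ K := by rw [hKdef]; exact hy'x
  haveI : CompactSpace ↥K := isCompact_iff_compactSpace.mp hK.isClosed.isCompact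
  haveI : ConnectedSpace ↥K := Subtype.connectedSpace (by rw [hKdef]; exact isConnected_connectedComponent)
  letI : ChartedSpace (EuclideanHalfSpace (n + 1)) ↥K :=
    (inferInstance : ChartedSpace (EuclideanHalfSpace (n + 1)) ↥(⟨K, hK.isOpen⟩ : TopologicalSpace.Opens X))
  have hBK : (𝓡∂ (n + 1)).boundary ↥K = Subtype.val ⁻¹' (𝓡∂ (n + 1)).boundary X :=
    ModelWithCorners.boundary_open (I := 𝓡∂ (n + 1)) (u := ⟨K, hK.isOpen⟩)
  -- the collapse `r : X → K` based at `b = y'`, a map of pairs `(X, ∂X) → (K, ∂K)`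
  obtain ⟨b, hbdef⟩ : ∃ b : ↥K, b = ⟨y', hy'K⟩ := ⟨_, rfl⟩
  obtain ⟨r, hrdef⟩ : ∃ r : C(X, ↥K), r = clopenCollapse K hK b := ⟨_, rfl⟩
  have hr_mem : ∀ z (hz : z ∈ K), r z = ⟨z, hz⟩ := fun z hz => by
    rw [hrdef]; exact clopenCollapse_apply_of_mem K hK b z hz
  have hr_nmem : ∀ z, z ∉ K → r z = b := fun z hz => by
    rw [hrdef]; exact clopenCollapse_apply_of_not_mem K hK b z hz
  have hrB : MapsTo r ((𝓡∂ (n + 1)).boundary X) ((𝓡∂ (n + 1)).boundary ↥K) := by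
    intro z hz
    rw [hBK, mem_preimage]
    by_cases hzK : z ∈ K
    · rw [hr_mem z hzK]; exact hz
    · rw [hr_nmem z hzK, hbdef]; exact hy'
  obtain ⟨wK, hwK⟩ : ∃ wK, wK = Literature.AlgebraicTopology.SingularHomology.relativeSingularHomology.map R R r hrB (n + 1) w := ⟨_, rfl⟩
  -- the boundary restriction `rB : ∂X → ∂K` and the test point `rB yB`, `yB = y`
  obtain ⟨rB, hrBdef⟩ : ∃ rB : C(↥((𝓡∂ (n + 1)).boundary X), ↥((𝓡∂ (n + 1)).boundary ↥K)),
      rB = Literature.AlgebraicTopology.SingularHomology.subsetRestrict r hrB := ⟨_, rfl⟩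
  obtain ⟨yB, hyBdef⟩ : ∃ yB : ↥((𝓡∂ (n + 1)).boundary X), yB = ⟨y, hy⟩ := ⟨_, rfl⟩
  have hyBval : (yB : X) = y := by rw [hyBdef]
  have hrB_apply : ∀ z, rB z = ⟨r (z : X), hrB z.2⟩ := fun z => by rw [hrBdef]; rfl
  have hδ : Literature.AlgebraicTopology.SingularHomology.relativeSingularHomology.δ R R ↥K ((𝓡∂ (n + 1)).boundary ↥K) n wK =
      Literature.AlgebraicTopology.SingularHomology.singularHomology.map R R rB n (Literature.AlgebraicTopology.SingularHomology.relativeSingularHomology.δ R R X ((𝓡∂ (n + 1)).boundary X) n w) := by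
    rw [hwK, hrBdef]
    change (Literature.AlgebraicTopology.SingularHomology.relativeSingularHomology.map R R r hrB (n + 1) ≫
        Literature.AlgebraicTopology.SingularHomology.relativeSingularHomology.δ R R ↥K ((𝓡∂ (n + 1)).boundary ↥K) n) w =
      (Literature.AlgebraicTopology.SingularHomology.relativeSingularHomology.δ R R X ((𝓡∂ (n + 1)).boundary X) n ≫
        Literature.AlgebraicTopology.SingularHomology.singularHomology.map R R (Literature.AlgebraicTopology.SingularHomology.subsetRestrict r hrB) n) w
    rw [Literature.AlgebraicTopology.SingularHomology.relativeSingularHomology.δ_naturality]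
  have hrBy : MapsTo rB ({yB}ᶜ : Set _) ({rB yB}ᶜ : Set _) := by
    intro z hz h
    apply hz
    rw [mem_singleton_iff] at h ⊢
    rw [hrB_apply, hrB_apply, Subtype.mk.injEq] at h
    change r (z : X) = r (yB : X) at h
    rw [hyBval, hr_mem y hyK] at h
    by_cases hzK : (z : X) ∈ K
    · rw [hr_mem _ hzK, Subtype.mk.injEq] at h
      exact Subtype.ext (h.trans hyBval.symm)
    · rw [hr_nmem _ hzK, hbdef, Subtype.mk.injEq] at h
      exact absurd h (Ne.symm hyy')
  -- the inclusion `jB : ∂K → ∂X`, an open embedding with `rB ∘ jB = id`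
  have hjB_mem : ∀ z : ↥((𝓡∂ (n + 1)).boundary ↥K), ((z : ↥K) : X) ∈ (𝓡∂ (n + 1)).boundary X :=
    fun z => hBK.subset z.2
  obtain ⟨jB, hjBdef⟩ : ∃ jB : C(↥((𝓡∂ (n + 1)).boundary ↥K), ↥((𝓡∂ (n + 1)).boundary X)),
      jB = ⟨fun z => ⟨((z : ↥K) : X), hjB_mem z⟩,
        (continuous_subtype_val.comp continuous_subtype_val).subtype_mk _⟩ := ⟨_, rfl⟩
  have hjB_val : ∀ z, ((jB z : X)) = ((z : ↥K) : X) := fun z => by rw [hjBdef]; rfl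
  have hrj : rB.comp jB = ContinuousMap.id _ := by
    refine ContinuousMap.ext fun z => Subtype.ext (Subtype.ext ?_)
    change ((rB (jB z) : ↥K) : X) = ((z : ↥K) : X)
    rw [hrB_apply]
    change ((r (jB z : X) : ↥K) : X) = ((z : ↥K) : X)
    rw [hjB_val, hr_mem _ (z : ↥K).2]
  have hjBemb : IsOpenEmbedding jB := by
    refine ⟨⟨?_, ?_⟩, ?_⟩
    · have hcomp : IsInducing ((Subtype.val : ↥((𝓡∂ (n + 1)).boundary X) → X) ∘ jB) := by
        have heq : ((Subtype.val : ↥((𝓡∂ (n + 1)).boundary X) → X) ∘ jB) =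
            (Subtype.val : ↥K → X) ∘ (Subtype.val : ↥((𝓡∂ (n + 1)).boundary ↥K) → ↥K) :=
          funext fun z => hjB_val z
        rw [heq]
        exact IsInducing.subtypeVal.comp IsInducing.subtypeVal
      exact (IsInducing.subtypeVal.of_comp_iff).mp hcomp
    · intro z z' h
      exact Subtype.ext (Subtype.ext (by rw [← hjB_val, ← hjB_val, h]))
    · have hrange : range jB = (Subtype.val ⁻¹' K : Set ↥((𝓡∂ (n + 1)).boundary X)) := by
        ext t
        constructor
        · rintro ⟨z, rfl⟩
          rw [mem_preimage, hjB_val]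
          exact (z : ↥K).2
        · intro ht
          refine ⟨⟨⟨(t : X), ht⟩, ?_⟩, Subtype.ext (by rw [hjB_val])⟩
          rw [hBK]
          exact t.2
      rw [hrange]
      exact hK.isOpen.preimage continuous_subtype_val
  have hjr : jB (rB yB) = yB := by
    apply Subtype.ext
    rw [hjB_val, hrB_apply]
    change ((r (yB : X) : ↥K) : X) = (yB : X)
    rw [hyBval, hr_mem y hyK]
  have hjBy : MapsTo jB ({rB yB}ᶜ : Set _) ({yB}ᶜ : Set _) := by
    intro z hz h
    apply hz
    rw [mem_singleton_iff] at h ⊢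
    apply hjBemb.injective
    rw [h, hjr]
  haveI : IsIso (Literature.AlgebraicTopology.SingularHomology.relativeSingularHomology.map R R jB hjBy n) := by
    have key : ∀ (t : ↥((𝓡∂ (n + 1)).boundary X)) (_ht : jB (rB yB) = t)
        (h' : MapsTo jB ({rB yB}ᶜ : Set _) ({t}ᶜ : Set _)),
        IsIso (Literature.AlgebraicTopology.SingularHomology.relativeSingularHomology.map R R jB h' n) := by
      rintro t rfl h'
      exact Literature.AlgebraicTopology.SingularHomology.localHomology.isIso_map_of_isOpenEmbedding R R jB hjBemb (rB yB) h' n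
    exact key yB hjr hjBy
  haveI hrBiso : IsIso (Literature.AlgebraicTopology.SingularHomology.relativeSingularHomology.map R R rB hrBy n) :=
    Literature.AlgebraicTopology.SingularHomology.localHomology.isIso_map_of_comp_eq_id R R jB rB hrj (rB yB) hjBy hrBy n
  -- Step A: the local image of `∂ wK` at `rB yB` is a generator
  have hA : ∃ e : Literature.AlgebraicTopology.SingularHomology.localHomology R R ↥((𝓡∂ (n + 1)).boundary ↥K) (rB yB) n ≃ₗ[R] R,
      e (Literature.AlgebraicTopology.SingularHomology.singularHomology.toLocal R R (rB yB) n
        (Literature.AlgebraicTopology.SingularHomology.relativeSingularHomology.δ R R ↥K ((𝓡∂ (n + 1)).boundary ↥K) n wK)) = 1 := by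
    rw [hδ, Literature.AlgebraicTopology.SingularHomology.singularHomology.toLocal_map_apply R R rB yB (rB yB) hrBy n]
    exact (exists_linearEquiv_apply_eq_one_iff_of_isIso _ _).mpr (hgen yB)
  -- Step B: `wK ≠ 0`
  have hwK0 : wK ≠ 0 := by
    intro h0
    apply ne_zero_of_exists_linearEquiv_apply_eq_one hA
    rw [h0, map_zero, map_zero]
  -- Step C: Spanier 6.3.5 and 6.3.10 on the component: `wK` is a fundamental class of `K`
  obtain ⟨e, he⟩ := h635 ⟨wK, hwK0⟩
  have hg₀ : Literature.AlgebraicTopology.SingularHomology.IsRelFundamentalClass R ((𝓡∂ (n + 1)).boundary ↥K) (e.symm 1) :=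
    he _ (by rw [LinearEquiv.apply_symm_apply]; exact isUnit_one)
  have hwKg : wK = e wK • e.symm 1 := by
    apply e.injective
    rw [map_smul, LinearEquiv.apply_symm_apply, smul_eq_mul, mul_one]
  have hunit : IsUnit (e wK) := by
    obtain ⟨e₁, he₁⟩ := h6310 _ hg₀ (rB yB)
    have hu := isUnit_apply_of_exists_linearEquiv_apply_eq_one hA e₁
    rwa [hwKg, map_smul, map_smul, map_smul, he₁, smul_eq_mul, mul_one] at hu
  have hfundK : Literature.AlgebraicTopology.SingularHomology.IsRelFundamentalClass R ((𝓡∂ (n + 1)).boundary ↥K) wK := he wK hunit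
  -- Step D: back to `X` at the interior point `x`
  have hxK' : (⟨(x : X), hxK⟩ : ↥K) ∈ ((𝓡∂ (n + 1)).boundary ↥K)ᶜ := by
    rw [hBK]
    exact x.2
  obtain ⟨e₂, he₂⟩ := hfundK ⟨⟨(x : X), hxK⟩, hxK'⟩
  have hxb : (⟨(x : X), hxK⟩ : ↥K) ≠ b := by
    intro h
    apply x.2
    rw [hbdef, Subtype.mk.injEq] at h
    rw [h]
    exact hy'
  have hrx : MapsTo r ({(x : X)}ᶜ : Set X) ({(⟨(x : X), hxK⟩ : ↥K)}ᶜ : Set ↥K) := by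
    rw [hrdef]; exact mapsTo_clopenCollapse_compl_singleton K hK b ⟨x, hxK⟩ hxb
  have hrincl : r.comp (Literature.AlgebraicTopology.SingularHomology.subsetIncl K) = ContinuousMap.id ↥K := by
    rw [hrdef]; exact clopenCollapse_comp_subsetIncl K hK b
  haveI : IsIso (Literature.AlgebraicTopology.SingularHomology.relativeSingularHomology.map R R (Literature.AlgebraicTopology.SingularHomology.subsetIncl K)
      (Literature.AlgebraicTopology.SingularHomology.localHomology.mapsTo_subsetIncl_compl hxK) (n + 1)) :=
    Literature.AlgebraicTopology.SingularHomology.localHomology.isIso_map_subsetIncl_of_isOpen R R hK.isOpen hxK (n + 1)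
  haveI : IsIso (Literature.AlgebraicTopology.SingularHomology.relativeSingularHomology.map R R r hrx (n + 1)) :=
    Literature.AlgebraicTopology.SingularHomology.localHomology.isIso_map_of_comp_eq_id R R (Literature.AlgebraicTopology.SingularHomology.subsetIncl K) r hrincl ⟨(x : X), hxK⟩
      (Literature.AlgebraicTopology.SingularHomology.localHomology.mapsTo_subsetIncl_compl hxK) hrx (n + 1)
  have hnat := Literature.AlgebraicTopology.SingularHomology.relativeSingularHomology.toLocal_map_apply R R r hrB x ⟨⟨(x : X), hxK⟩, hxK'⟩ hrx
    (n + 1) w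
  rw [hwK, hnat] at he₂
  exact (exists_linearEquiv_apply_eq_one_iff_of_isIso
    (Literature.AlgebraicTopology.SingularHomology.relativeSingularHomology.map R R r hrx (n + 1)) _).mp ⟨e₂, he₂⟩

end Fundamental

/-! ### The hypothesis on `∂w` for a boundary splitting -/

namespace BoundarySplitting

variable {n : ℕ} {M N W : Type u} [TopologicalSpace M] [TopologicalSpace N] [TopologicalSpace W]
  [ChartedSpace (EuclideanHalfSpace (n + 1)) W]

/-- The first end of a boundary splitting is an open embedding into `∂W` (compact ends,
Hausdorff `W`: `∂W ≅ M ⊔ N`). [folklore] -/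
theorem isOpenEmbedding_iMB [CompactSpace M] [CompactSpace N] [T2Space W] (s : BoundarySplitting n M N W) :
    IsOpenEmbedding s.iMB := by
  have h : (s.iMB : M → _) = s.homeomorph ∘ Sum.inl := funext fun x => (s.homeomorph_inl x).symm
  rw [h]
  exact s.homeomorph.isOpenEmbedding.comp IsOpenEmbedding.inl

/-- The second end of a boundary splitting is an open embedding into `∂W`. [folklore] -/
theorem isOpenEmbedding_iNB [CompactSpace M] [CompactSpace N] [T2Space W] (s : BoundarySplitting n M N W) :
    IsOpenEmbedding s.iNB := by
  have h : (s.iNB : N → _) = s.homeomorph ∘ Sum.inr := funext fun x => (s.homeomorph_inr x).symm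
  rw [h]
  exact s.homeomorph.isOpenEmbedding.comp IsOpenEmbedding.inr

/-- The two ends never meet in `∂W`. [folklore] -/
lemma iNB_ne_iMB (s : BoundarySplitting n M N W) (x : M) (y : N) : s.iNB y ≠ s.iMB x := by
  intro h
  exact Set.disjoint_left.mp s.disjoint_range ⟨x, rfl⟩ ⟨y, congrArg Subtype.val h⟩

/-- **`[M] − [N]` is a fundamental class of `∂W = M ⊔ N`, locally**: for a boundary splitting
with compact ends and fundamental classes `cM`, `cN` of `R`-orientations `μ`, `ν` of the ends,
the class `(iM)_* cM − (iN)_* cN ∈ Hₙ(∂W; R)` restricts to a generator of `Hₙ(∂W | y; R)` at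
every `y ∈ ∂W` (to the transported `μₓ` on `M`, to `−νₓ` on `N`; the other end contributes
nothing since it misses `y`).  Local homology is local (Hatcher 2002, §3.3 p. 231) and `iM`,
`iN` are open embeddings. [cite: Hatcher2002, §3.3 pp. 231–236] -/
theorem isGenerator_toLocal_of_eq_sub {R : Type v} [CommRing R] [CompactSpace M] [CompactSpace N]
    [T2Space W] (s : BoundarySplitting n M N W) (μ : Literature.AlgebraicTopology.SingularHomology.HomologicalOrientation R M n) (ν : Literature.AlgebraicTopology.SingularHomology.HomologicalOrientation R N n)
    {cM : ↥(Literature.AlgebraicTopology.SingularHomology.singularHomology R R M n)} {cN : ↥(Literature.AlgebraicTopology.SingularHomology.singularHomology R R N n)}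
    (hcM : Literature.AlgebraicTopology.SingularHomology.IsFundamentalClass μ cM) (hcN : Literature.AlgebraicTopology.SingularHomology.IsFundamentalClass ν cN)
    (v : ↥(Literature.AlgebraicTopology.SingularHomology.singularHomology R R ↥((𝓡∂ (n + 1)).boundary W) n))
    (hv : v = Literature.AlgebraicTopology.SingularHomology.singularHomology.map R R s.iMB n cM - Literature.AlgebraicTopology.SingularHomology.singularHomology.map R R s.iNB n cN)
    (y : ↥((𝓡∂ (n + 1)).boundary W)) :
    ∃ e : Literature.AlgebraicTopology.SingularHomology.localHomology R R ↥((𝓡∂ (n + 1)).boundary W) y n ≃ₗ[R] R,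
      e (Literature.AlgebraicTopology.SingularHomology.singularHomology.toLocal R R y n v) = 1 := by
  subst hv
  obtain ⟨m, rfl⟩ | ⟨m, rfl⟩ : (∃ m, s.iMB m = y) ∨ (∃ m, s.iNB m = y) := by
    have hy : (y : W) ∈ Set.range s.iM ∪ Set.range s.iN := by rw [s.range_union]; exact y.2
    rcases hy with ⟨m, hm⟩ | ⟨m, hm⟩
    · exact Or.inl ⟨m, Subtype.ext hm⟩
    · exact Or.inr ⟨m, Subtype.ext hm⟩
  · have hmaps := mapsTo_compl_singleton_of_injective s.iMB s.isOpenEmbedding_iMB.injective m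
    rw [map_sub, Literature.AlgebraicTopology.SingularHomology.singularHomology.toLocal_map_apply R R s.iMB m (s.iMB m) hmaps n,
      Literature.AlgebraicTopology.SingularHomology.singularHomology.toLocal_map_eq_zero_of_forall_ne R R s.iNB (s.iMB m) (fun m' => s.iNB_ne_iMB m m') n,
      sub_zero, hcM m]
    haveI := Literature.AlgebraicTopology.SingularHomology.localHomology.isIso_map_of_isOpenEmbedding R R s.iMB s.isOpenEmbedding_iMB m hmaps n
    exact (exists_linearEquiv_apply_eq_one_iff_of_isIso _ _).mpr (μ.isGenerator m)
  · have hmaps := mapsTo_compl_singleton_of_injective s.iNB s.isOpenEmbedding_iNB.injective m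
    rw [map_sub, Literature.AlgebraicTopology.SingularHomology.singularHomology.toLocal_map_eq_zero_of_forall_ne R R s.iMB (s.iNB m)
        (fun m' h => s.iNB_ne_iMB m' m h.symm) n,
      Literature.AlgebraicTopology.SingularHomology.singularHomology.toLocal_map_apply R R s.iNB m (s.iNB m) hmaps n, zero_sub, hcN m, ← map_neg]
    haveI := Literature.AlgebraicTopology.SingularHomology.localHomology.isIso_map_of_isOpenEmbedding R R s.iNB s.isOpenEmbedding_iNB m hmaps n
    exact (exists_linearEquiv_apply_eq_one_iff_of_isIso _ _).mpr
      (exists_linearEquiv_apply_eq_one_neg (ν.isGenerator m))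

/-- With empty ends, Thom's rank vanishes (the target `Hᵏ(M)/T ⊕ Hᵏ(N)/T` is zero). [folklore] -/
theorem restrictRank_eq_zero_of_isEmpty (R : Type v) [CommRing R] [Nontrivial R] [IsEmpty M] [IsEmpty N]
    (s : BoundarySplitting n M N W) (k : ℕ) : s.restrictRank R k = 0 := by
  haveI : Subsingleton ↥(freeCohomologyPair R M N k) :=
    inferInstanceAs (Subsingleton (↥(Literature.AlgebraicTopology.SingularHomology.freeCohomology R M k) × ↥(Literature.AlgebraicTopology.SingularHomology.freeCohomology R N k)))
  exact Module.finrank_zero_of_subsingleton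

end BoundarySplitting

/-! ### Two boundary points in every component of the essential part -/

/-- A topological manifold of positive dimension has no isolated points: every point has another
point in its connected component (the component is open, and a coordinate chart would make an
isolated point an open point of `ℝⁿ`, `n ≥ 1`). [folklore] -/
theorem exists_ne_mem_connectedComponent_of_chartedSpace {n : ℕ} (hn : n ≠ 0) {M : Type u}
    [TopologicalSpace M] [ChartedSpace (EuclideanSpace ℝ (Fin n)) M] (m : M) :
    ∃ m' : M, m' ≠ m ∧ m' ∈ connectedComponent m := by
  haveI : LocallyConnectedSpace M := ChartedSpace.locallyConnectedSpace (EuclideanSpace ℝ (Fin n)) M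
  by_contra h
  have hcc : connectedComponent m = {m} := by
    refine Set.Subset.antisymm (fun m' hm' => mem_singleton_iff.mpr ?_)
      (Set.singleton_subset_iff.2 mem_connectedComponent)
    by_contra hne
    exact h ⟨m', hne, hm'⟩
  have hopen : IsOpen ({m} : Set M) := hcc ▸ isOpen_connectedComponent
  set e := chartAt (EuclideanSpace ℝ (Fin n)) m
  have h1 : IsOpen (e '' {m}) :=
    e.isOpen_image_of_subset_source hopen (Set.singleton_subset_iff.2 (mem_chart_source _ m))
  rw [Set.image_singleton] at h1
  haveI : Nontrivial (EuclideanSpace ℝ (Fin n)) :=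
    Module.nontrivial_of_finrank_pos (R := ℝ) (by rw [finrank_euclideanSpace_fin]; omega)
  exact (Real.punctured_nhds_module_neBot (e m)).ne ((isOpen_singleton_iff_punctured_nhds _).1 h1)

namespace Cobordism

variable {n : ℕ} {M N : Type u} [TopologicalSpace M] [ChartedSpace (EuclideanSpace ℝ (Fin n)) M]
  [TopologicalSpace N] [ChartedSpace (EuclideanSpace ℝ (Fin n)) N]

/-- Components of the essential part may be computed in `W`: if `z` lies in the component of `x`
in `W`, it lies in the component of `x` in `W'` (components of `W` through points of `W'` are
contained in the clopen `W'`). [folklore] -/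
lemma mem_connectedComponent_essentialOpens (c : Cobordism n M N) {x z : ↥c.essentialOpens}
    (h : (z : c.W) ∈ connectedComponent (x : c.W)) : z ∈ connectedComponent x := by
  have hsub : connectedComponent (x : c.W) ⊆ c.essentialPart := c.connectedComponent_subset_essentialPart x.2
  have hpre : IsPreconnected (Subtype.val ⁻¹' connectedComponent (x : c.W) : Set ↥c.essentialOpens) :=
    isPreconnected_connectedComponent.preimage_of_isOpenMap Subtype.val_injective
      c.isClopen_essentialPart.isOpen.isOpenMap_subtype_val (fun y hy => ⟨⟨y, hsub hy⟩, rfl⟩)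
  exact hpre.subset_connectedComponent (show x ∈ Subtype.val ⁻¹' connectedComponent (x : c.W) from
    mem_connectedComponent) h

/-- **Every component of the essential part contains two distinct boundary points** (for ends
of positive dimension `n`): a point `x ∈ W'` lies in the component of some `b ∈ ∂W`, `b` is an
end point `inl m` or `inr m`, and a second point of the component of `m` in the end (a manifold
of positive dimension has no isolated points) gives a second boundary point of the component.
[folklore] -/
theorem exists_boundary_pair_essentialOpens (hn : n ≠ 0) (c : Cobordism n M N) (x : ↥c.essentialOpens) :
    ∃ y ∈ (𝓡∂ (n + 1)).boundary ↥c.essentialOpens, ∃ y' ∈ (𝓡∂ (n + 1)).boundary ↥c.essentialOpens,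
      y ≠ y' ∧ y ∈ connectedComponent x ∧ y' ∈ connectedComponent x := by
  obtain ⟨b, hb, hxb⟩ : ∃ b ∈ (𝓡∂ (n + 1)).boundary c.W, (x : c.W) ∈ connectedComponent b := by
    simpa only [Cobordism.mem_essentialOpens, essentialPart, mem_iUnion, exists_prop] using x.2
  have hbx : b ∈ connectedComponent (x : c.W) := by
    rw [← connectedComponent_eq hxb]
    exact mem_connectedComponent
  have key : ∀ (P : Type u) [TopologicalSpace P] [ChartedSpace (EuclideanSpace ℝ (Fin n)) P]
      (f : P → c.W), Continuous f → Function.Injective f →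
      (∀ p, f p ∈ (𝓡∂ (n + 1)).boundary c.W) → ∀ p, f p = b →
      ∃ y ∈ (𝓡∂ (n + 1)).boundary ↥c.essentialOpens, ∃ y' ∈ (𝓡∂ (n + 1)).boundary ↥c.essentialOpens,
        y ≠ y' ∧ y ∈ connectedComponent x ∧ y' ∈ connectedComponent x := by
    intro P _ _ f hf hinj hfB p hp
    obtain ⟨p', hp'p, hp'⟩ := exists_ne_mem_connectedComponent_of_chartedSpace hn p
    have hbB : b ∈ (𝓡∂ (n + 1)).boundary c.W := hp ▸ hfB p
    refine ⟨⟨b, c.boundary_subset_essentialPart hbB⟩, (c.mem_boundary_essentialOpens_iff _).mpr hbB,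
      ⟨f p', c.boundary_subset_essentialPart (hfB p')⟩, (c.mem_boundary_essentialOpens_iff _).mpr (hfB p'),
      ?_, ?_, ?_⟩
    · intro h
      apply hp'p
      apply hinj
      rw [hp]
      exact (congrArg Subtype.val h).symm
    · exact c.mem_connectedComponent_essentialOpens hbx
    · apply c.mem_connectedComponent_essentialOpens
      have hpre : IsPreconnected (f '' connectedComponent p) :=
        isPreconnected_connectedComponent.image f hf.continuousOn
      have hsub := hpre.subset_connectedComponent (show b ∈ f '' connectedComponent p from
        ⟨p, mem_connectedComponent, hp⟩)
      change f p' ∈ connectedComponent (x : c.W)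
      rw [← connectedComponent_eq hxb]
      exact hsub ⟨p', hp', rfl⟩
  have hb' : b ∈ Set.range c.inl ∪ Set.range c.inr := by rw [c.range_inl_union_range_inr]; exact hb
  rcases hb' with ⟨m, hm⟩ | ⟨m, hm⟩
  · exact key M c.inl c.continuous_inl c.isSmoothEmbedding_inl.isEmbedding.injective c.inl_mem_boundary m hm
  · exact key N c.inr c.continuous_inr c.isSmoothEmbedding_inr.isEmbedding.injective c.inr_mem_boundary m hm

/-- The collapse map of `BordismFourNormalization` is the clopen collapse onto the essential
part. [folklore] -/
theorem collapse_eq_clopenCollapse (c : Cobordism n M N) (p : ↥c.essentialOpens) :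
    c.collapse p = clopenCollapse c.essentialPart c.isClopen_essentialPart p := rfl

/-- With empty ends, Thom's rank of a cobordism vanishes. [folklore] -/
theorem boundaryImageRank_eq_zero_of_isEmpty (R : Type v) [CommRing R] [Nontrivial R] [IsEmpty M] [IsEmpty N]
    (c : Cobordism n M N) (k : ℕ) : c.boundaryImageRank R k = 0 := by
  haveI : Subsingleton ↥(freeCohomologyPair R M N k) :=
    inferInstanceAs (Subsingleton (↥(Literature.AlgebraicTopology.SingularHomology.freeCohomology R M k) × ↥(Literature.AlgebraicTopology.SingularHomology.freeCohomology R N k)))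
  exact Module.finrank_zero_of_subsingleton

/-- If `∂W = ∅` the essential part is empty. [folklore] -/
theorem isEmpty_essentialOpens (c : Cobordism n M N) (h : (𝓡∂ (n + 1)).boundary c.W = ∅) :
    IsEmpty ↥c.essentialOpens := by
  refine ⟨fun x => ?_⟩
  obtain ⟨b, hb, -⟩ : ∃ b ∈ (𝓡∂ (n + 1)).boundary c.W, (x : c.W) ∈ connectedComponent b := by
    simpa only [Cobordism.mem_essentialOpens, essentialPart, mem_iUnion, exists_prop] using x.2
  rw [h] at hb
  exact hb

end Cobordism

/-! ### `hA1`: normalization of the bordism datum, and the assembled leaf -/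

section SPC4

/-- **Normalization of an oriented-bordism datum** (hypothesis `hA1` of
`two_mul_boundaryImageRank_eq_of_normalization`, discharged modulo named textbook facts): every
homological oriented bordism `(c, w)` between closed oriented smooth 4-manifolds `(M, μ)`,
`(N, ν)` — `w ∈ H₅(W, ∂W; ℤ)` with `∂w = (inl)_*[M] − (inr)_*[N]` — is replaced by an
`Literature.Topology.FourManifolds.OrientedSplitting` with the same Thom rank `r₂`: the essential part `W'` of `W` (components
meeting `∂W`) with the transported class `w' = g_* w`, which is a relative fundamental class by
`isRelFundamentalClass_of_isGenerator_toLocal_δ`; if `∂W = ∅` then `M = N = ∅`, `W' = ∅` and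
`w' = 0`.  Inputs: Spanier Thm. 6.3.5 (`h635`) and Cor. 6.3.10 (`h6310`) for compact
5-manifolds with boundary, and the fundamental class of closed oriented 4-manifolds (`hμ`,
Hatcher Thm. 3.26, named fact `HomologicalOrientation.isFundamentalClass_fundamentalClass`).
This is the classical remark that the homological definition of oriented bordism agrees with
the geometric one (Milnor–Stasheff 1974, §17 p. 200; docstring of `IsOrientedBordant`).
[cite: Spanier1981, Ch. 6 Sec. 3 Thm. 5 and Cor. 10; Hatcher2002, §3.3 Thm. 3.26] -/
theorem exists_orientedSplitting
    (h635 : ∀ {W : Type u} [TopologicalSpace W] [T2Space W] [CompactSpace W] [ConnectedSpace W]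
      [ChartedSpace (EuclideanHalfSpace (4 + 1)) W]
      (h : ∃ z : ↥(Literature.AlgebraicTopology.SingularHomology.relativeSingularHomology ℤ ℤ W ((𝓡∂ (4 + 1)).boundary W) (4 + 1)), z ≠ 0),
      Literature.AlgebraicTopology.SingularHomology.relativeSingularHomology.exists_linearEquiv_of_ne_zero ℤ 4 W h)
    (h6310 : ∀ {W : Type u} [TopologicalSpace W] [T2Space W] [CompactSpace W]
      [ChartedSpace (EuclideanHalfSpace (4 + 1)) W]
      (z : ↥(Literature.AlgebraicTopology.SingularHomology.relativeSingularHomology ℤ ℤ W ((𝓡∂ (4 + 1)).boundary W) (4 + 1)))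
      (hz : Literature.AlgebraicTopology.SingularHomology.IsRelFundamentalClass ℤ ((𝓡∂ (4 + 1)).boundary W) z),
      Literature.AlgebraicTopology.SingularHomology.isGenerator_toLocal_δ_of_isRelFundamentalClass ℤ 4 W z hz)
    (hμ : ∀ {P : Type u} [TopologicalSpace P],
      Literature.AlgebraicTopology.SingularHomology.HomologicalOrientation.isFundamentalClass_fundamentalClass (R := ℤ) (X := P) (n := 4))
    {M N : Type u} [TopologicalSpace M] [T2Space M] [SecondCountableTopology M]
    [ChartedSpace (EuclideanSpace ℝ (Fin 4)) M] [CompactSpace M] [IsManifold (𝓡 4) ∞ M]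
    [TopologicalSpace N] [T2Space N] [SecondCountableTopology N]
    [ChartedSpace (EuclideanSpace ℝ (Fin 4)) N] [CompactSpace N] [IsManifold (𝓡 4) ∞ N]
    (μ : Literature.AlgebraicTopology.SingularHomology.HomologicalOrientation ℤ M 4) (ν : Literature.AlgebraicTopology.SingularHomology.HomologicalOrientation ℤ N 4) (c : Cobordism 4 M N)
    (w : ↥(Literature.AlgebraicTopology.SingularHomology.relativeSingularHomology ℤ ℤ c.W ((𝓡∂ (4 + 1)).boundary c.W) (4 + 1)))
    (hw : Literature.AlgebraicTopology.SingularHomology.relativeSingularHomology.δ ℤ ℤ c.W ((𝓡∂ (4 + 1)).boundary c.W) 4 w =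
      Literature.AlgebraicTopology.SingularHomology.singularHomology.map ℤ ℤ c.inlBoundary 4 μ.fundamentalClass -
        Literature.AlgebraicTopology.SingularHomology.singularHomology.map ℤ ℤ c.inrBoundary 4 ν.fundamentalClass) :
    ∃ d : OrientedSplitting 4 M N μ ν, c.boundaryImageRank ℤ 2 = d.splitting.restrictRank ℤ 2 := by
  by_cases hB : ((𝓡∂ (4 + 1)).boundary c.W).Nonempty
  · obtain ⟨p₀, hp₀⟩ := hB
    set p : ↥c.essentialOpens := ⟨p₀, c.boundary_subset_essentialPart hp₀⟩
    have hδ := c.δ_collapseClass (R := ℤ) p w μ.fundamentalClass ν.fundamentalClass hw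
    refine ⟨OrientedSplitting.mk (↥c.essentialOpens) c.essentialSplitting (c.collapseClass p (4 + 1) w) hδ ?_,
      c.boundaryImageRank_eq_restrictRank_essentialSplitting p 2⟩
    exact isRelFundamentalClass_of_isGenerator_toLocal_δ h635 h6310 _
      (c.essentialSplitting.isGenerator_toLocal_of_eq_sub μ ν (hμ μ) (hμ ν) _ hδ)
      (c.exists_boundary_pair_essentialOpens four_ne_zero)
  · have hB' : (𝓡∂ (4 + 1)).boundary c.W = ∅ := Set.not_nonempty_iff_eq_empty.mp hB
    haveI : IsEmpty M := ⟨fun m => hB ⟨c.inl m, c.inl_mem_boundary m⟩⟩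
    haveI : IsEmpty N := ⟨fun m => hB ⟨c.inr m, c.inr_mem_boundary m⟩⟩
    haveI : IsEmpty ↥c.essentialOpens := c.isEmpty_essentialOpens hB'
    have hZ := isZero_singularHomology_of_isEmpty ℤ ℤ (↥((𝓡∂ (4 + 1)).boundary ↥c.essentialOpens)) 4
    refine ⟨OrientedSplitting.mk (↥c.essentialOpens) c.essentialSplitting 0 ?_ (fun x => isEmptyElim x), ?_⟩
    · exact (eq_zero_of_isZero ℤ hZ _).trans (eq_zero_of_isZero ℤ hZ _).symm
    · change c.boundaryImageRank ℤ 2 = c.essentialSplitting.restrictRank ℤ 2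
      rw [c.boundaryImageRank_eq_zero_of_isEmpty ℤ 2, c.essentialSplitting.restrictRank_eq_zero_of_isEmpty ℤ 2]

/-- **The leaf `two_mul_boundaryImageRank_eq` (Thom 1952, Cor. V.8 for `n = 4`, `p = 2`) from
textbook named facts only**: Spanier Thm. 6.3.5 (`h635`), Cor. 6.3.10 (`h6310`), Thm. 6.3.12 =
Lefschetz duality (`hL`), Cor. 6.2.21 (`hFW`); Hatcher Thm. 3.2 (`hU1`, `hU2`), Thm. 3.30 (`hD`),
Cor. A.8–A.9 (`hF2`, `hF₂`, `hF₁`).  Everything else — the fundamental class of the ends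
(Hatcher Thm. 3.26, `isFundamentalClass_fundamentalClass_holds`), the normalization of the
bordism datum (Layers 4a–4b), the duality ladder and rank count (Layer 3), the isotropy of Thom's
`A²` (Layer 2) — is proved.  PROVED. [cite: Thom1952, Cor. V.8 (p. 173)] -/
theorem two_mul_boundaryImageRank_eq_of_facts
    (h635 : ∀ {W : Type u} [TopologicalSpace W] [T2Space W] [CompactSpace W] [ConnectedSpace W]
      [ChartedSpace (EuclideanHalfSpace (4 + 1)) W]
      (h : ∃ z : ↥(Literature.AlgebraicTopology.SingularHomology.relativeSingularHomology ℤ ℤ W ((𝓡∂ (4 + 1)).boundary W) (4 + 1)), z ≠ 0),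
      Literature.AlgebraicTopology.SingularHomology.relativeSingularHomology.exists_linearEquiv_of_ne_zero ℤ 4 W h)
    (h6310 : ∀ {W : Type u} [TopologicalSpace W] [T2Space W] [CompactSpace W]
      [ChartedSpace (EuclideanHalfSpace (4 + 1)) W]
      (z : ↥(Literature.AlgebraicTopology.SingularHomology.relativeSingularHomology ℤ ℤ W ((𝓡∂ (4 + 1)).boundary W) (4 + 1)))
      (hz : Literature.AlgebraicTopology.SingularHomology.IsRelFundamentalClass ℤ ((𝓡∂ (4 + 1)).boundary W) z),
      Literature.AlgebraicTopology.SingularHomology.isGenerator_toLocal_δ_of_isRelFundamentalClass ℤ 4 W z hz)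
    (hL : ∀ {W : Type u} [TopologicalSpace W] [T2Space W] [CompactSpace W]
      [ChartedSpace (EuclideanHalfSpace (4 + 1)) W]
      (z : ↥(Literature.AlgebraicTopology.SingularHomology.relativeSingularHomology ℤ ℤ W ((𝓡∂ (4 + 1)).boundary W) (4 + 1)))
      (hz : Literature.AlgebraicTopology.SingularHomology.IsRelFundamentalClass ℤ ((𝓡∂ (4 + 1)).boundary W) z),
      Literature.AlgebraicTopology.SingularHomology.bijective_relCapProduct_of_isRelFundamentalClass ℤ 4 W z hz (show 2 + (2 + 1) = 4 + 1 by rfl))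
    (hFW : ∀ {W : Type u} [TopologicalSpace W] [T2Space W] [CompactSpace W]
      [ChartedSpace (EuclideanHalfSpace (4 + 1)) W]
      (z : ↥(Literature.AlgebraicTopology.SingularHomology.relativeSingularHomology ℤ ℤ W ((𝓡∂ (4 + 1)).boundary W) (4 + 1)))
      (hz : Literature.AlgebraicTopology.SingularHomology.IsRelFundamentalClass ℤ ((𝓡∂ (4 + 1)).boundary W) z),
      Literature.AlgebraicTopology.SingularHomology.finite_singularHomology_of_isRelFundamentalClass ℤ 4 W z hz 2)
    (hU1 : ∀ {W : Type u} [TopologicalSpace W], Literature.AlgebraicTopology.SingularHomology.kroneckerMap_surjective ℤ W 2)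
    (hU2 : ∀ {X : Type u} [TopologicalSpace X], Literature.AlgebraicTopology.SingularHomology.ker_kroneckerMap_le_torsion ℤ X 1)
    (hD : ∀ {P : Type u} [TopologicalSpace P] [T2Space P] [CompactSpace P]
      [ChartedSpace (EuclideanSpace ℝ (Fin 4)) P] (π : Literature.AlgebraicTopology.SingularHomology.HomologicalOrientation ℤ P 4),
      Literature.AlgebraicTopology.SingularHomology.bijective_poincareDualityMap π two_add_two_eq_four)
    (hF2 : ∀ {P : Type u} [TopologicalSpace P] [T2Space P] [CompactSpace P]
      [ChartedSpace (EuclideanSpace ℝ (Fin 4)) P], Literature.AlgebraicTopology.SingularHomology.finite_singularCohomology_of_compactSpace ℤ P 4 2)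
    (hF₂ : ∀ {P : Type u} [TopologicalSpace P] [T2Space P] [CompactSpace P]
      [ChartedSpace (EuclideanSpace ℝ (Fin 4)) P], Literature.AlgebraicTopology.SingularHomology.finite_singularHomology_of_compactSpace ℤ P 4 2)
    (hF₁ : ∀ {P : Type u} [TopologicalSpace P] [T2Space P] [CompactSpace P]
      [ChartedSpace (EuclideanSpace ℝ (Fin 4)) P], Literature.AlgebraicTopology.SingularHomology.finite_singularHomology_of_compactSpace ℤ P 4 1) :
    two_mul_boundaryImageRank_eq.{u} :=
  two_mul_boundaryImageRank_eq_of_normalization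
    (fun μ ν c w hw => exists_orientedSplitting h635 h6310
      (fun {P} _ => Literature.AlgebraicTopology.SingularHomology.HomologicalOrientation.isFundamentalClass_fundamentalClass_holds (R := ℤ) (X := P) 4)
      μ ν c w hw)
    hL hFW hU1 (fun {X} _ => @hU2 X _) hD hF2 hF₂ hF₁

/-- **spc4.S36 from textbook named facts and Thom's Thm IV.13**: the forward direction
(bordism invariance of the signature, Thom 1954 Thm IV.1 = Thom 1952 Cor. V.11) is now proved
down to the standard theorems of algebraic topology listed in
`two_mul_boundaryImageRank_eq_of_facts` plus Sylvester's law of inertia for the cup form (`hS`);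
the converse is Thom's computation `Ω₄ ≅ ℤ` (`h₂`, Thm IV.13, a theory of its own).  PROVED.
[cite: ThomCMH1954, Thm IV.1 and Thm IV.13; Thom1952, Cor. V.8] -/
theorem isOrientedBordant_iff_signature_eq_of_facts
    (h635 : ∀ {W : Type u} [TopologicalSpace W] [T2Space W] [CompactSpace W] [ConnectedSpace W]
      [ChartedSpace (EuclideanHalfSpace (4 + 1)) W]
      (h : ∃ z : ↥(Literature.AlgebraicTopology.SingularHomology.relativeSingularHomology ℤ ℤ W ((𝓡∂ (4 + 1)).boundary W) (4 + 1)), z ≠ 0),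
      Literature.AlgebraicTopology.SingularHomology.relativeSingularHomology.exists_linearEquiv_of_ne_zero ℤ 4 W h)
    (h6310 : ∀ {W : Type u} [TopologicalSpace W] [T2Space W] [CompactSpace W]
      [ChartedSpace (EuclideanHalfSpace (4 + 1)) W]
      (z : ↥(Literature.AlgebraicTopology.SingularHomology.relativeSingularHomology ℤ ℤ W ((𝓡∂ (4 + 1)).boundary W) (4 + 1)))
      (hz : Literature.AlgebraicTopology.SingularHomology.IsRelFundamentalClass ℤ ((𝓡∂ (4 + 1)).boundary W) z),
      Literature.AlgebraicTopology.SingularHomology.isGenerator_toLocal_δ_of_isRelFundamentalClass ℤ 4 W z hz)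
    (hL : ∀ {W : Type u} [TopologicalSpace W] [T2Space W] [CompactSpace W]
      [ChartedSpace (EuclideanHalfSpace (4 + 1)) W]
      (z : ↥(Literature.AlgebraicTopology.SingularHomology.relativeSingularHomology ℤ ℤ W ((𝓡∂ (4 + 1)).boundary W) (4 + 1)))
      (hz : Literature.AlgebraicTopology.SingularHomology.IsRelFundamentalClass ℤ ((𝓡∂ (4 + 1)).boundary W) z),
      Literature.AlgebraicTopology.SingularHomology.bijective_relCapProduct_of_isRelFundamentalClass ℤ 4 W z hz (show 2 + (2 + 1) = 4 + 1 by rfl))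
    (hFW : ∀ {W : Type u} [TopologicalSpace W] [T2Space W] [CompactSpace W]
      [ChartedSpace (EuclideanHalfSpace (4 + 1)) W]
      (z : ↥(Literature.AlgebraicTopology.SingularHomology.relativeSingularHomology ℤ ℤ W ((𝓡∂ (4 + 1)).boundary W) (4 + 1)))
      (hz : Literature.AlgebraicTopology.SingularHomology.IsRelFundamentalClass ℤ ((𝓡∂ (4 + 1)).boundary W) z),
      Literature.AlgebraicTopology.SingularHomology.finite_singularHomology_of_isRelFundamentalClass ℤ 4 W z hz 2)
    (hU1 : ∀ {W : Type u} [TopologicalSpace W], Literature.AlgebraicTopology.SingularHomology.kroneckerMap_surjective ℤ W 2)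
    (hU2 : ∀ {X : Type u} [TopologicalSpace X], Literature.AlgebraicTopology.SingularHomology.ker_kroneckerMap_le_torsion ℤ X 1)
    (hD : ∀ {P : Type u} [TopologicalSpace P] [T2Space P] [CompactSpace P]
      [ChartedSpace (EuclideanSpace ℝ (Fin 4)) P] (π : Literature.AlgebraicTopology.SingularHomology.HomologicalOrientation ℤ P 4),
      Literature.AlgebraicTopology.SingularHomology.bijective_poincareDualityMap π two_add_two_eq_four)
    (hF2 : ∀ {P : Type u} [TopologicalSpace P] [T2Space P] [CompactSpace P]
      [ChartedSpace (EuclideanSpace ℝ (Fin 4)) P], Literature.AlgebraicTopology.SingularHomology.finite_singularCohomology_of_compactSpace ℤ P 4 2)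
    (hF₂ : ∀ {P : Type u} [TopologicalSpace P] [T2Space P] [CompactSpace P]
      [ChartedSpace (EuclideanSpace ℝ (Fin 4)) P], Literature.AlgebraicTopology.SingularHomology.finite_singularHomology_of_compactSpace ℤ P 4 2)
    (hF₁ : ∀ {P : Type u} [TopologicalSpace P] [T2Space P] [CompactSpace P]
      [ChartedSpace (EuclideanSpace ℝ (Fin 4)) P], Literature.AlgebraicTopology.SingularHomology.finite_singularHomology_of_compactSpace ℤ P 4 1)
    (hS : ∀ {P : Type u} [TopologicalSpace P] [T2Space P] [CompactSpace P]
      [ChartedSpace (EuclideanSpace ℝ (Fin 4)) P] (π : Literature.AlgebraicTopology.SingularHomology.HomologicalOrientation ℤ P 4),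
      Literature.AlgebraicTopology.SingularHomology.sigPos_add_sigNeg_intersectionForm even_two two_add_two_eq_four π)
    (h₂ : isOrientedBordant_of_signature_eq.{u}) : isOrientedBordant_iff_signature_eq.{u} :=
  isOrientedBordant_iff_signature_eq_of_boundaryImageRank
    (two_mul_boundaryImageRank_eq_of_facts h635 h6310 hL hFW hU1 (fun {X} _ => @hU2 X _) hD hF2 hF₂ hF₁)
    hS hF2 h₂

end SPC4

end Literature.Topology.FourManifolds

end
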